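import Literature.ModelTheory.FiniteModelTheory.LFPEvalProgram
import Literature.ModelTheory.FiniteModelTheory.LFPDefinability
import HarnessLib

/-!
# The Immerman–Vardi theorem, assembled (discharge of `immerman_vardi`)

Topic `Literature/ModelTheory/FiniteModelTheory`. The named fact `immerman_vardi` of `LFP.lean`
(Immerman 1986 / Vardi 1982; Immerman 1999, Thm. 4.10; Libkin 2004, Thm. 10.14; Gurevich 1984,
§4 Theorem 3: over ORDERED finite structures FO(LFP) — rendered by the equi-expressive FO(IFP) —
captures `P`) was reduced there (`immerman_vardi_of`) to the two halves of Gurevich's Theorem 3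
for zero-ary global predicates with the natural order:

* `natModelClass_mem_P` — (3) → (1), FO(IFP) with order is in `P`: discharged in
  `LFPEvalProgram.lean` (`natModelClass_mem_P_holds`, the stack-program evaluator of
  `LFPEval.lean` run in polynomial time);
* `exists_sentence_natOrder_of_mem_P` — (1) → (3), `P` is FO(IFP)-definable with order:
  discharged in `LFPDefinability.lean` (`exists_sentence_natOrder_of_mem_P_holds`, the
  simulation of `FinTM2` runs of `LFPSimulation.lean` over the code read by `LFPCode.lean`).

This file only puts the two together. (It cannot live in `LFP.lean` itself: both discharges
import `LFP.lean`.)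

## References

* N. Immerman, *Relational queries computable in polynomial time*, Inform. and Control 68 (1986)
  86–104; N. Immerman, *Descriptive Complexity*, Springer 1999, Thm. 4.10.
* M. Y. Vardi, *The complexity of relational query languages*, STOC 1982, 137–146.
* Y. Gurevich, *Toward logic tailored for computational complexity*, LNM 1104 (1984), §4 Thm. 3.
* L. Libkin, *Elements of Finite Model Theory*, Springer 2004, Thm. 10.14.
-/

namespace Literature.ModelTheory.FiniteModelTheory

/-- **The Immerman–Vardi theorem** (discharge of the named fact `immerman_vardi` of `LFP.lean`):
for a distinguished binary symbol `o` and an isomorphism-closed class `C` of ordered finite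
`ar`-structures, `C` is FO(LFP)-definable on ordered structures iff its language of codes is in
`P`. Proof: `immerman_vardi_of` applied to the two discharged halves of Gurevich's Theorem 3,
`natModelClass_mem_P_holds` ((3) → (1)) and `exists_sentence_natOrder_of_mem_P_holds`
((1) → (3)). [Immerman 1999, Thm. 4.10; Immerman 1986; Vardi 1982; Gurevich 1984, §4 Theorem 3;
Libkin 2004, Thm. 10.14] [cite: Immerman1999, Thm. 4.10] -/
theorem immerman_vardi_holds : immerman_vardi :=
  immerman_vardi_of natModelClass_mem_P_holds exists_sentence_natOrder_of_mem_P_holds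

end Literature.ModelTheory.FiniteModelTheory
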